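import Literature.Analysis.FluidPDE.NSLocalAnalyticityRadiusUnitScale
import Literature.Analysis.FluidPDE.NSLocalAnalyticityRadiusEpsReg
import Literature.Analysis.FluidPDE.NSLocalAnalyticityRadiusDataComplex
import Literature.Analysis.FluidPDE.NSLocalAnalyticityRadiusScheme
import Literature.Analysis.FluidPDE.NSLocalAnalyticityRadiusCutoff
import HarnessLib

/-!
# Bradshaw–Grujić–Kukavica local analyticity radius: assembly of the proof

Analysis/FluidPDE proofs-layer file (theorems only) closing the named fact
`Literature.Analysis.FluidPDE.bradshawGrujicKukavica2015_local_analyticity_radius`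
(Bradshaw–Grujić–Kukavica 2015, Thm. 2.3) through its reduced core
`bradshawGrujicKukavica2015_local_analyticity_radius_of_small` (`R = 12`):

1. the concrete cut-off `cutoff12 x₁` (`NSLocalAnalyticityRadiusCutoff`) with centre-independent
   bounds for `∇χ`, `Δχ`;
2. `ε`-regularity (`NSLocalAnalyticityRadiusEpsReg`) bounds `u` by `K√ε₀` on
   `[1/16, 144) × B(x₁, 11)`; Hölder bounds `∫_{B̄(x₁,9)}|p(s)| ≤ |B̄₉|^{1/3} ε₀`;
3. the datum `DATA`/`DATA_ℂ` of the localised scheme from the base time `s₀ = 1/2`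
   (`NSLocalAnalyticityRadiusData(Complex)`) satisfies the hypotheses of the contour scheme
   (`NSLocalAnalyticityRadiusScheme.IsSchemeRun`) for `ε₀` below an explicit threshold, with the
   aperture `c = min 1 (1/(4L₀))` and the complex radius `ρ₀ = 1/(16Λ)`;
4. the localised velocity `v = χu` is the bounded fixed point `v = DATA - B_{s₀}(v,v)`
   (`locVelocity_eq_locData_sub`), so the scheme yields a holomorphic extension of
   `v(1, ·) = u(1, ·)` on `Ω_1 ⊇ localComplexTube x₁ 1 (c/√2)`.

## References

* Z. Bradshaw, Z. Grujić, I. Kukavica, J. Differential Equations 259 (2015), Thm. 2.3, §3–§4.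
  [BradshawGrujicKukavica2015]
-/

noncomputable section

open MeasureTheory Set Function Filter Metric Real
open _root_.Topology
open scoped ENNReal NNReal ContDiff Laplacian InnerProductSpace RealInnerProductSpace
open Literature.Analysis.FunctionSpaces.EuclideanSpace (complexify complexify_apply norm_complexify
  complexify_injective continuous_complexify)

namespace Literature.Analysis.FluidPDE

namespace BGK2015

/-! ### The pressure in `L¹(B̄(x₁, 9))` from `L^{3/2}(B(x₁, 12))` -/

/-- **Hölder on the annulus carrier**: if `f` is continuous on `B̄(x₁, 9)` and
`‖f‖_{L^{3/2}(B(x₁,12))} ≤ ε`, then `∫_{B̄(x₁,9)} |f| ≤ |B̄₉|^{1/3} ε`. [folklore] -/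
theorem integral_abs_le_of_eLpNorm_three_halves {f : EuclideanSpace ℝ (Fin 3) → ℝ} {x₁ : EuclideanSpace ℝ (Fin 3)}
    (hf : ContinuousOn f (closedBall x₁ 9)) {ε : ℝ} (hε : 0 ≤ ε)
    (h32 : eLpNorm f (ENNReal.ofReal (3 / 2)) (volume.restrict (ball x₁ 12)) ≤ ENNReal.ofReal ε) :
    ∫ y in closedBall x₁ 9, |f y| ≤
      (volume (closedBall (0 : EuclideanSpace ℝ (Fin 3)) 9)).toReal ^ (1 / 3 : ℝ) * ε := by
  set μ : Measure (EuclideanSpace ℝ (Fin 3)) := volume.restrict (closedBall x₁ 9) with hμ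
  have hKc : IsCompact (closedBall x₁ (9 : ℝ)) := isCompact_closedBall _ _
  have hfi : IntegrableOn f (closedBall x₁ 9) := hf.integrableOn_compact hKc
  have hfm : AEStronglyMeasurable f μ := hfi.aestronglyMeasurable
  -- `L¹ ≤ L^{3/2} · μ(univ)^{1/3}`
  have hp : (1 : ℝ≥0∞) ≤ ENNReal.ofReal (3 / 2) := by
    rw [← ENNReal.ofReal_one]; exact ENNReal.ofReal_le_ofReal (by norm_num)
  have h1 := eLpNorm_le_eLpNorm_mul_rpow_measure_univ hp hfm
  have hexp : 1 / (1 : ℝ≥0∞).toReal - 1 / (ENNReal.ofReal (3 / 2)).toReal = (1 / 3 : ℝ) := by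
    rw [ENNReal.toReal_one, ENNReal.toReal_ofReal (by norm_num)]; norm_num
  rw [hexp] at h1
  have hμuniv : μ univ = volume (closedBall x₁ 9) := by rw [hμ, Measure.restrict_apply_univ]
  have hvol : volume (closedBall x₁ (9 : ℝ)) = volume (closedBall (0 : EuclideanSpace ℝ (Fin 3)) 9) :=
    Measure.addHaar_closedBall_center _ _ _
  -- monotonicity in the measure
  have hmono : eLpNorm f (ENNReal.ofReal (3 / 2)) μ ≤ eLpNorm f (ENNReal.ofReal (3 / 2)) (volume.restrict (ball x₁ 12)) :=
    eLpNorm_mono_measure f (Measure.restrict_mono (closedBall_subset_ball (by norm_num)) le_rfl)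
  have h2 : eLpNorm f 1 μ ≤ ENNReal.ofReal ε * volume (closedBall (0 : EuclideanSpace ℝ (Fin 3)) 9) ^ (1 / 3 : ℝ) := by
    calc eLpNorm f 1 μ ≤ eLpNorm f (ENNReal.ofReal (3 / 2)) μ * μ univ ^ (1 / 3 : ℝ) := h1
      _ ≤ ENNReal.ofReal ε * volume (closedBall (0 : EuclideanSpace ℝ (Fin 3)) 9) ^ (1 / 3 : ℝ) := by
          rw [hμuniv, hvol]
          gcongr
          exact hmono.trans h32
  -- back to the Bochner integral
  have hint : ∫ y in closedBall x₁ 9, |f y| = (eLpNorm f 1 μ).toReal := by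
    rw [eLpNorm_one_eq_lintegral_enorm, ← hμ]
    have h := integral_norm_eq_lintegral_enorm hfm
    simp only [Real.norm_eq_abs] at h
    exact h
  rw [hint]
  have hfin : ENNReal.ofReal ε * volume (closedBall (0 : EuclideanSpace ℝ (Fin 3)) 9) ^ (1 / 3 : ℝ) ≠ ⊤ :=
    ENNReal.mul_ne_top ENNReal.ofReal_ne_top
      (ENNReal.rpow_ne_top_of_nonneg (by norm_num) (isCompact_closedBall _ _).measure_lt_top.ne)
  calc (eLpNorm f 1 μ).toReal ≤ (ENNReal.ofReal ε * volume (closedBall (0 : EuclideanSpace ℝ (Fin 3)) 9) ^ (1 / 3 : ℝ)).toReal :=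
        ENNReal.toReal_mono hfin h2
    _ = (volume (closedBall (0 : EuclideanSpace ℝ (Fin 3)) 9)).toReal ^ (1 / 3 : ℝ) * ε := by
        rw [ENNReal.toReal_mul, ENNReal.toReal_ofReal hε, ← ENNReal.toReal_rpow, mul_comm]

/-! ### Local tubes are monotone in the height -/

/-- `localComplexTube x₀ ρ h ⊆ localComplexTube x₀ ρ h'` for `h ≤ h'`. [folklore] -/
theorem localComplexTube_mono_height (x₀ : EuclideanSpace ℝ (Fin 3)) (ρ : ℝ) {h h' : ℝ} (hh : h ≤ h') :
    localComplexTube x₀ ρ h ⊆ localComplexTube x₀ ρ h' := by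
  rintro z ⟨x, y, hx, hy, rfl⟩
  exact ⟨x, y, hx, hy.trans_le hh, rfl⟩

/-! ### The proof of the fact -/

/-- Continuity of a pressure slice on `B̄(x₁, 9)` (a compact subset of the data ball). [folklore] -/
theorem continuousOn_pressure_slice {x₁ : EuclideanSpace ℝ (Fin 3)} {δ : ℝ}
    {u : ℝ → EuclideanSpace ℝ (Fin 3) → EuclideanSpace ℝ (Fin 3)} {p : ℝ → EuclideanSpace ℝ (Fin 3) → ℝ}
    (hsol : IsCylinderSolution x₁ δ 12 u p) {s : ℝ} (hs : s ∈ Ioo (-δ) ((12 : ℝ) ^ 2)) :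
    ContinuousOn (p s) (closedBall x₁ 9) := by
  have h1 : ContinuousOn (uncurry p) (Ioo (-δ) ((12 : ℝ) ^ 2) ×ˢ ball x₁ 12) := hsol.smooth_pressure.continuousOn
  exact h1.comp (continuousOn_const.prodMk continuousOn_id) fun y hy =>
    ⟨hs, (closedBall_subset_ball (by norm_num)) hy⟩

end BGK2015

set_option maxHeartbeats 1600000 in
open BGK2015 in
/-- **Bradshaw–Grujić–Kukavica's local analyticity radius theorem holds**
(`bradshawGrujicKukavica2015_local_analyticity_radius`): the reduced unit-scale core
`bradshawGrujicKukavica2015_local_analyticity_radius_of_small` with `R = 12`, closed by the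
contour Picard scheme (`NSLocalAnalyticityRadiusScheme`) run on the datum of the localised Oseen
representation (`NSLocalAnalyticityRadiusData(Complex)`), for `ε₀` below an explicit threshold.
[cite: BradshawGrujicKukavica2015, Thm. 2.3 and §3–§4] -/
theorem bradshawGrujicKukavica2015_local_analyticity_radius_holds :
    bradshawGrujicKukavica2015_local_analyticity_radius := by
  classical
  -- absolute constants
  obtain ⟨ε₁, K, hε₁, hK, hE⟩ := exists_forall_norm_le_of_small
  obtain ⟨C_B, hCB0, hCB⟩ := exists_norm_oseenDuhamel_le_mul (E := EuclideanSpace ℝ (Fin 3))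
  obtain ⟨Cf, hCf0, hCf⟩ := exists_norm_integral_oseenKernelC_flat_le_local (n := 2)
  obtain ⟨L₀, hL₀0, hL₀, hLip⟩ := exists_bump2_lipschitz
  obtain ⟨C_H, hCH0, hCH⟩ := exists_abs_deriv_stepH_le
  obtain ⟨L₁, L₂, hL₁0, hL₂0, hcut⟩ := exists_cutoff12_bounds
  obtain ⟨A, hA0, hA⟩ := exists_norm_locDataC_le hL₁0 hL₂0
  set Vf : ℝ := (volume (closedBall (0 : EuclideanSpace ℝ (Fin 3)) 9)).toReal ^ (1 / 3 : ℝ) with hVf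
  have hVf0 : 0 ≤ Vf := Real.rpow_nonneg ENNReal.toReal_nonneg _
  -- the aperture and the complex radius
  set c : ℝ := min 1 (1 / (4 * L₀)) with hc
  have hc0 : 0 < c := lt_min one_pos (by positivity)
  have hc1 : c ≤ 1 := min_le_left _ _
  have hcL : c * L₀ ≤ 1 / 4 := by
    have h : c ≤ 1 / (4 * L₀) := min_le_right _ _
    calc c * L₀ ≤ 1 / (4 * L₀) * L₀ := mul_le_mul_of_nonneg_right h hL₀0.le
      _ = 1 / 4 := by field_simp
  set Λ : ℝ := (1 + c * 1 * L₀ * (1 + 2 * C_H)) * Cf with hΛ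
  have hΛ0 : 0 < Λ := by positivity
  set ρ₀ : ℝ := 1 / (16 * Λ) with hρ₀
  have hρ₀0 : 0 < ρ₀ := by positivity
  have hΛρ : Λ * ρ₀ = 1 / 16 := by rw [hρ₀]; field_simp
  -- the size threshold
  set m : ℝ := min 1 (min (7 * ρ₀ / (24 * (A + 1))) (min (ρ₀ / (2 * (1 + 2 * C_B))) (1 / (16 * C_B * (1 + 2 * C_B)))))
    with hm
  have hm0 : 0 < m := lt_min one_pos (lt_min (by positivity) (lt_min (by positivity) (by positivity)))
  have hm1 : m ≤ 1 := min_le_left _ _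
  have hmA : 3 * (A + 1) * m ≤ 7 * ρ₀ / 8 := by
    have h : m ≤ 7 * ρ₀ / (24 * (A + 1)) := (min_le_right _ _).trans (min_le_left _ _)
    rw [le_div_iff₀ (by positivity)] at h
    linarith
  have hmρ : 2 * (1 + 2 * C_B) * m ≤ ρ₀ := by
    have h : m ≤ ρ₀ / (2 * (1 + 2 * C_B)) := ((min_le_right _ _).trans (min_le_right _ _)).trans (min_le_left _ _)
    rw [le_div_iff₀ (by positivity)] at h
    linarith
  have hmB : 16 * C_B * (1 + 2 * C_B) * m ≤ 1 := by
    have h : m ≤ 1 / (16 * C_B * (1 + 2 * C_B)) := ((min_le_right _ _).trans (min_le_right _ _)).trans (min_le_right _ _)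
    rw [le_div_iff₀ (by positivity)] at h
    linarith
  -- the smallness parameter
  set ε₀ : ℝ := min ε₁ (min 1 (min ((m / K) ^ 2) (m / (Vf + 1)))) with hε₀
  have hε₀0 : 0 < ε₀ := lt_min hε₁ (lt_min one_pos (lt_min (by positivity) (by positivity)))
  have hε₀1 : ε₀ ≤ ε₁ := min_le_left _ _
  have hKε : K * Real.sqrt ε₀ ≤ m := by
    have h : ε₀ ≤ (m / K) ^ 2 := ((min_le_right _ _).trans (min_le_right _ _)).trans (min_le_left _ _)
    have h2 : Real.sqrt ε₀ ≤ m / K := by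
      rw [Real.sqrt_le_left (by positivity)]; exact h
    calc K * Real.sqrt ε₀ ≤ K * (m / K) := mul_le_mul_of_nonneg_left h2 hK.le
      _ = m := by field_simp
  have hVε : Vf * ε₀ ≤ m := by
    have h : ε₀ ≤ m / (Vf + 1) := ((min_le_right _ _).trans (min_le_right _ _)).trans (min_le_right _ _)
    rw [le_div_iff₀ (by positivity)] at h
    rw [show Vf * ε₀ = ε₀ * (Vf + 1) - ε₀ by ring]
    linarith [hε₀0.le]
  -- the output constant
  set κ : ℝ := c * Real.sqrt (1 - 1 / 2) with hκ
  have hκ0 : 0 < κ := by positivity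
  set C₀ : ℝ := 1 / (4 * κ) with hC₀
  have hC₀0 : 0 < C₀ := by positivity
  have hC₀κ : 1 / (4 * C₀) = κ := by rw [hC₀]; field_simp
  refine bradshawGrujicKukavica2015_local_analyticity_radius_of_small (R := 12) (ε₀ := ε₀) (C₀ := C₀)
    (by norm_num) hε₀0 hC₀0 ?_
  intro x₁ δ hδ u p hu hp hns hdiv hu3 hp32 hgrad
  -- the solution and the cut-off
  have hsol : IsSmallCylinderSolution x₁ δ 12 ε₀ u p := .of_hypotheses hu hp hns hdiv hu3 hp32 hgrad
  have hcyl : IsCylinderSolution x₁ δ 12 u p := hsol.toIsCylinderSolution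
  have hχ : IsLocCutoff x₁ 12 (cutoff12 x₁) := isLocCutoff_cutoff12 x₁
  have hL₁ : ∀ y, ‖gradient (cutoff12 x₁) y‖ ≤ L₁ := fun y => (hcut x₁ y).1
  have hL₂ : ∀ y, |(Δ (cutoff12 x₁)) y| ≤ L₂ := fun y => (hcut x₁ y).2
  -- times
  have hI : Icc (1 / 2 : ℝ) (3 / 2) ⊆ Ioo (-δ) ((12 : ℝ) ^ 2) := fun s hs => ⟨by linarith [hs.1], by linarith [hs.2]⟩
  have hs₀ : -δ < 1 / 2 := by linarith
  have ht₁ : (3 / 2 : ℝ) < (12 : ℝ) ^ 2 := by norm_num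
  have hT : (3 / 2 : ℝ) - 1 / 2 ≤ 1 := by norm_num
  have hsq : Real.sqrt ((3 / 2 : ℝ) - 1 / 2) = 1 := by norm_num
  -- `M_u = K√ε₀`
  set Mu : ℝ := K * Real.sqrt ε₀ with hMu
  have hMu0 : 0 ≤ Mu := by positivity
  have hMum : Mu ≤ m := hKε
  have hMu1 : Mu ≤ 1 := hMum.trans hm1
  have hMu2 : Mu ^ 2 ≤ Mu := by
    calc Mu ^ 2 = Mu * Mu := sq Mu
      _ ≤ Mu * 1 := mul_le_mul_of_nonneg_left hMu1 hMu0
      _ = Mu := mul_one _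
  have hMub : ∀ s ∈ Icc (1 / 2 : ℝ) (3 / 2), ∀ y ∈ ball x₁ 11, ‖u s y‖ ≤ Mu := by
    intro s hs y hy
    have h := hE hε₀0 hε₀1 x₁ hδ (by norm_num : (1 : ℝ) ≤ 12) hu hp hns hdiv hu3 hp32 s
      ⟨by linarith [hs.1], by linarith [hs.2]⟩ y (by norm_num; exact hy)
    exact h
  -- `M_p = |B̄₉|^{1/3} ε₀`
  set Mp : ℝ := Vf * ε₀ with hMp
  have hMp0 : 0 ≤ Mp := by positivity
  have hMpm : Mp ≤ m := hVε
  have hMpb : ∀ s ∈ Icc (1 / 2 : ℝ) (3 / 2), ∫ y in closedBall x₁ 9, |p s y| ≤ Mp := fun s hs =>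
    integral_abs_le_of_eLpNorm_three_halves (continuousOn_pressure_slice hcyl (hI hs)) hε₀0.le (hp32 s (hI hs))
  -- the datum sizes
  set D₀ : ℝ := Mu + C_B * Mu ^ 2 * 2 with hD₀
  have hD₀0 : 0 ≤ D₀ := by positivity
  have hD₀le : D₀ ≤ (1 + 2 * C_B) * m := by
    have h1 : C_B * Mu ^ 2 * 2 ≤ C_B * Mu * 2 :=
      mul_le_mul_of_nonneg_right (mul_le_mul_of_nonneg_left hMu2 hCB0.le) zero_le_two
    calc D₀ = Mu + C_B * Mu ^ 2 * 2 := rfl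
      _ ≤ Mu + C_B * Mu * 2 := by linarith
      _ = (1 + 2 * C_B) * Mu := by ring
      _ ≤ (1 + 2 * C_B) * m := mul_le_mul_of_nonneg_left hMum (by positivity)
  set D₀' : ℝ := A * (Mu + Mu ^ 2 + Mp) with hD₀'
  have hD₀'0 : 0 ≤ D₀' := by positivity
  have hD₀'le : D₀' ≤ 7 * ρ₀ / 8 := by
    have h1 : Mu + Mu ^ 2 + Mp ≤ 3 * m := by linarith
    calc D₀' ≤ A * (3 * m) := mul_le_mul_of_nonneg_left h1 hA0
      _ = 3 * (A + 1) * m - 3 * m := by ring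
      _ ≤ 3 * (A + 1) * m := by linarith [hm0.le]
      _ ≤ 7 * ρ₀ / 8 := hmA
  -- bounds of `v` on the slab
  have hMv : ∀ s ∈ Ioo (1 / 2 : ℝ) (3 / 2), ∀ y, ‖locVelocity (cutoff12 x₁) u s y‖ ≤ Mu := fun s hs y =>
    norm_locVelocity_le' hχ hMub (Ioo_subset_Icc_self hs) y
  have hCB1 : ∀ {u v : ℝ → EuclideanSpace ℝ (Fin 3) → EuclideanSpace ℝ (Fin 3)} {s t Mu Mv : ℝ}, s < t →
      0 ≤ Mu → 0 ≤ Mv → (∀ τ ∈ Ioo s t, ∀ y, ‖u τ y‖ ≤ Mu) → (∀ τ ∈ Ioo s t, ∀ y, ‖v τ y‖ ≤ Mv) → ∀ x,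
      ‖oseenDuhamel 1 s u v t x‖ ≤ C_B * Mu * Mv * (1 : ℝ) ^ (-(1 / 2 : ℝ)) * (2 * Real.sqrt (t - s)) :=
    fun hst hMu hMv hu hv x => hCB one_pos hst hMu hMv hu hv x
  -- the scheme datum
  have hDat : IsSchemeDatum x₁ c (1 / 2) (3 / 2) D₀ D₀' (locData x₁ 12 (cutoff12 x₁) u p (1 / 2))
      (locDataC x₁ 12 (cutoff12 x₁) u p (1 / 2)) := by
    refine ⟨aestronglyMeasurable_uncurry_locData hcyl hχ hs₀ ht₁, hD₀0, fun t ht x => ?_, hD₀'0,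
      fun t ht ζ hζ => ?_, fun t ht => ?_, fun t ht x => ?_⟩
    · have h := norm_locData_le hcyl hχ hs₀ ht₁ hCB1 hMu0 hMv ht x
      refine h.trans ?_
      have hsqt : Real.sqrt (t - 1 / 2) ≤ 1 := by rw [Real.sqrt_le_one]; linarith [ht.2]
      rw [hD₀]
      have : C_B * Mu ^ 2 * (2 * Real.sqrt (t - 1 / 2)) ≤ C_B * Mu ^ 2 * 2 := by
        have h0 : 0 ≤ C_B * Mu ^ 2 := by positivity
        calc C_B * Mu ^ 2 * (2 * Real.sqrt (t - 1 / 2)) ≤ C_B * Mu ^ 2 * (2 * 1) := by gcongr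
          _ = C_B * Mu ^ 2 * 2 := by ring
      linarith
    · obtain ⟨x, y, rfl, hx, -, hyψ, hyκ, -⟩ := mem_region hζ
      have hy1 : ‖y‖ ≤ Real.sqrt (t - 1 / 2) := by
        refine hyψ.le.trans ?_
        have hA1 : c * Real.sqrt (t - 1 / 2) ≤ Real.sqrt (t - 1 / 2) := mul_le_of_le_one_left (Real.sqrt_nonneg _) hc1
        calc c * Real.sqrt (t - 1 / 2) * bump2 x₁ x ≤ Real.sqrt (t - 1 / 2) * bump2 x₁ x :=
              mul_le_mul_of_nonneg_right hA1 (bump2_nonneg _ _)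
          _ ≤ Real.sqrt (t - 1 / 2) := mul_le_of_le_one_right (Real.sqrt_nonneg _) (bump2_le_one _ _)
      have hy2 : ‖y‖ ≤ 1 := by
        refine hyκ.le.trans ?_
        have hsqt : Real.sqrt (t - 1 / 2) ≤ 1 := by rw [Real.sqrt_le_one]; linarith [ht.2]
        calc c * Real.sqrt (t - 1 / 2) ≤ 1 * 1 := by gcongr
          _ = 1 := one_mul _
      exact hA hcyl hχ hL₁ hL₂ hI hT hMu0 hMub hMp0 hMpb ht hx hy1 hy2
    · refine differentiableOn_locDataC hcyl hχ hI hT hL₁ hMu0 hMub ht (isOpen_region _ _ _ _) fun ζ hζ => ?_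
      obtain ⟨x, y, rfl, hx, -, hyψ, hyκ, -⟩ := mem_region hζ
      have hsqt : Real.sqrt (t - 1 / 2) ≤ 1 := by rw [Real.sqrt_le_one]; linarith [ht.2]
      refine ⟨x, y, rfl, hx, hyψ.le.trans ?_, hyκ.le.trans ?_⟩
      · have hA1 : c * Real.sqrt (t - 1 / 2) ≤ Real.sqrt (t - 1 / 2) := mul_le_of_le_one_left (Real.sqrt_nonneg _) hc1
        calc c * Real.sqrt (t - 1 / 2) * bump2 x₁ x ≤ Real.sqrt (t - 1 / 2) * bump2 x₁ x :=
              mul_le_mul_of_nonneg_right hA1 (bump2_nonneg _ _)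
          _ ≤ Real.sqrt (t - 1 / 2) := mul_le_of_le_one_right (Real.sqrt_nonneg _) (bump2_le_one _ _)
      · calc c * Real.sqrt (t - 1 / 2) ≤ 1 * 1 := by gcongr
          _ = 1 := one_mul _
    · exact locDataC_complexify hcyl hχ hs₀ ht.1 (ht.2.trans ht₁) x
  -- the run of the scheme
  have hRun : IsSchemeRun x₁ c (1 / 2) (3 / 2) D₀ D₀' (locData x₁ 12 (cutoff12 x₁) u p (1 / 2))
      (locDataC x₁ 12 (cutoff12 x₁) u p (1 / 2)) C_B Cf L₀ C_H ρ₀ := by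
    refine ⟨hDat, hCB0, hCB1, ?_, hCf0, hCf, hL₀0, hL₀, hLip, hCH0, hCH, by norm_num, hc0, hc1, ?_, ?_, ?_, ?_⟩
    · -- `C_B (2D₀) 2√1 ≤ 1/4`
      rw [hsq]
      calc C_B * (2 * D₀) * (2 * 1) = 4 * C_B * D₀ := by ring
        _ ≤ 4 * C_B * ((1 + 2 * C_B) * m) := by gcongr
        _ = (16 * C_B * (1 + 2 * C_B) * m) / 4 := by ring
        _ ≤ 1 / 4 := by linarith
    · rw [hsq, mul_one]; exact hcL
    · linarith
    · rw [hsq]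
      have h1 : (1 + c * 1 * L₀ * (1 + 2 * C_H)) * Cf * ρ₀ ^ 2 * (2 * 1) = 2 * (Λ * ρ₀) * ρ₀ := by rw [hΛ]; ring
      rw [h1, hΛρ]
      linarith
    · rw [hsq]
      have h1 : (1 + c * 1 * L₀ * (1 + 2 * C_H)) * Cf * ρ₀ * (2 * 1) = 2 * (Λ * ρ₀) := by rw [hΛ]; ring
      rw [h1, hΛρ]
      norm_num
  -- the localised velocity is the bounded fixed point
  have hvm : AEStronglyMeasurable (uncurry (locVelocity (cutoff12 x₁) u))
      ((volume : Measure (ℝ × EuclideanSpace ℝ (Fin 3))).restrict (Ioo (1 / 2 : ℝ) (3 / 2) ×ˢ univ)) :=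
    aestronglyMeasurable_uncurry_locVelocity hcyl hχ hI
  have hvb : ∀ t ∈ Ioo (1 / 2 : ℝ) (3 / 2), ∀ x, ‖locVelocity (cutoff12 x₁) u t x‖ ≤ 2 * D₀ := by
    intro t ht x
    refine (hMv t ht x).trans ?_
    rw [hD₀]
    have : 0 ≤ C_B * Mu ^ 2 * 2 := by positivity
    linarith
  have hvfix : ∀ t ∈ Ioo (1 / 2 : ℝ) (3 / 2), ∀ x, locVelocity (cutoff12 x₁) u t x =
      locData x₁ 12 (cutoff12 x₁) u p (1 / 2) t x -
        oseenDuhamel 1 (1 / 2) (locVelocity (cutoff12 x₁) u) (locVelocity (cutoff12 x₁) u) t x :=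
    fun t ht x => locVelocity_eq_locData_sub hcyl hχ hs₀ ht.1 (ht.2.trans ht₁) x
  obtain ⟨U, hU, hUres⟩ := exists_differentiableOn_region_of_fixedPoint hRun hvm hvb hvfix
    (t := 1) (by norm_num)
  -- conclusion on the local tube over `B(x₁, 1)`
  have htube : localComplexTube x₁ 1 (1 / (4 * C₀)) ⊆ region x₁ c (1 / 2) 1 := by
    rw [hC₀κ]
    exact localComplexTube_subset_profileRegion x₁ κ
  refine ⟨U, hU.mono htube, fun x hx => ?_⟩
  have hxreg : complexify x ∈ region x₁ c (1 / 2) 1 := by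
    show complexify x ∈ profileRegion fun z => (c * Real.sqrt (1 - 1 / 2)) * bump2 x₁ z
    rw [complexify_mem_profileRegion_iff, bump2_eq_one_of_mem (ball_subset_closedBall hx), mul_one]
    exact hκ0
  rw [hUres x hxreg, locVelocity_apply, hχ.eq_one x ?_, one_smul]
  norm_num
  exact (closedBall_subset_closedBall (by norm_num)) (ball_subset_closedBall hx)

end Literature.Analysis.FluidPDE
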